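import Mathlib
import HarnessLib
import Summits.Ventures.LatticeQCDFlow.Exactness.PTBCTranslationErgodic

/-!
# PTBC: the law of the PHYSICAL replica alone converges to its Gibbs law at the joint chain's rate — observables read from one replica are asymptotically exact

HONEST FRAMING: exact (Metropolis-corrected) sampling algorithms for lattice gauge theory;
figures of merit are autocorrelation/cost numbers at stated couplings and volumes; no
continuum-physics claim.

Venture `LatticeQCDFlow` (cell pub-lqcd), topic `Exactness`; FANOUT row 22 (`su3-ptbc`, the PTBC
comparator arm E4, whose acceptance card says "replica 0 samples `e^{−S_W}` exactly; no reweighting;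
observables from replica 0 only", HOME `su3-ptbc/CARD-su3-ptbc.md` §1.4).  NEW WORK of the cell: a
corollary of row 9's full-cycle theorems (`Exactness/PTBCTranslationErgodic.lean`:
`ptbc_full_uniformlyErgodic`, `ptbcTarget_unique_invariant_full`; `PTBCHeatBathErgodic.lean`:
`ptbcTarget = ⊗_q piGibbsLaw μ (p q)`) and Mathlib's `MeasureTheory.measurePreserving_eval` (the
`r`-coordinate of a finite product of probability laws has the `r`-th factor as its law).  Nothing is
cited as a fact.

## Content

Those theorems control the JOINT law of all `R` replicas: `|μ₀Cᵗ(A) − (⊗_q π_q)(A)| ≤ ρᵗ` for every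
event `A` of the product space.  What the E4 arm USES is the law of ONE coordinate — the physical
(periodic) replica `r₀`, the only one that is measured.  Since the target is a product of probability
laws, its `r₀`-marginal is `π_{r₀} = Z⁻¹e^{−S_{r₀}}·⊗μ`, and an event of replica `r₀` is an event of the
product, so the bound transfers verbatim:

* §1 (abstract product) `pi_real_preimage_eval` — `(⊗_q π_q)(eval_r⁻¹ B) = π_r(B)`;
  **`abs_real_preimage_eval_sub_le`** — if a law `ν` on the product is within `δ` of `⊗π` on every
  event, its `r`-marginal is within `δ` of `π_r` on every event; `map_eval_pi` (the marginal of the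
  target IS the factor).
* §2 (PTBC) **`ptbc_full_physicalMarginal`** — under the hypotheses of `ptbc_full_uniformlyErgodic`
  (bounded measurable replica actions, heat-bath scans through every site of every replica, swaps along
  any list of pairs, the lifted translation of replica `r₀`), for EVERY replica `r`, every initial joint
  law `μ₀`, every `t` and every measurable event `B` of one replica's configurations:
  `|μ₀Cᵗ(eval_r⁻¹ B) − (Z_r⁻¹e^{−S_r}·⊗μ)(B)| ≤ (1 − ((e^{−b}/e^{−a})^{|l|})^{|L|})ᵗ` — the physical
  replica's statistics converge to the physical Gibbs law at the joint rate, with no reweighting and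
  whatever the other replicas are doing; **`ptbcTarget_marginal`** — at stationarity the law of replica
  `r` IS `Z_r⁻¹e^{−S_r}·⊗μ` exactly.

NOT CLAIMED: autocorrelation times of replica-`r₀` observables (the point of PTBC — measured, CARD §3);
anything beyond row 9's hypotheses (bounded actions; the identification of the engine's moves).
-/

noncomputable section

namespace Summit.Ventures.LatticeQCDFlow.Exactness

open MeasureTheory ProbabilityTheory Set Function
open scoped ENNReal

/-! ## §1 Marginals of a product target -/

section Marginal

variable {R : Type*} [Fintype R] {Y : R → Type*} [∀ r, MeasurableSpace (Y r)]
  (π : ∀ r, Measure (Y r)) [∀ r, IsProbabilityMeasure (π r)]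

/-- **The `r`-marginal of a finite product of probability laws is the `r`-th factor**, on events:
`(⊗π)(eval_r⁻¹ B) = π_r(B)`. [folklore] -/
theorem pi_real_preimage_eval (r : R) {B : Set (Y r)} (hB : MeasurableSet B) :
    (Measure.pi π).real (Function.eval r ⁻¹' B) = (π r).real B := by
  simp only [Measure.real]
  rw [(measurePreserving_eval π r).measure_preimage hB.nullMeasurableSet]

/-- The `r`-marginal of the product, as a measure: `(⊗π).map eval_r = π_r`. [folklore] -/
theorem map_eval_pi (r : R) : (Measure.pi π).map (Function.eval r) = π r :=
  (measurePreserving_eval π r).map_eq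

/-- **Transfer of a uniform event bound to one coordinate**: if `|ν(A) − (⊗π)(A)| ≤ δ` for every
event `A` of the product, then `|ν(eval_r⁻¹ B) − π_r(B)| ≤ δ` for every measurable `B`. [ours] -/
theorem abs_real_preimage_eval_sub_le {ν : Measure (∀ r, Y r)} {δ : ℝ}
    (h : ∀ A : Set (∀ r, Y r), |ν.real A - (Measure.pi π).real A| ≤ δ) (r : R) {B : Set (Y r)}
    (hB : MeasurableSet B) :
    |ν.real (Function.eval r ⁻¹' B) - (π r).real B| ≤ δ := by
  rw [← pi_real_preimage_eval π r hB]
  exact h _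

end Marginal

/-! ## §2 The physical replica of the full PTBC cycle -/

section PTBC

variable {R : Type*} [DecidableEq R] [Fintype R] {ι : Type*} [Fintype ι] [DecidableEq ι] {X : ι → Type*}
  [∀ j, MeasurableSpace (X j)] {μ : ∀ j, Measure (X j)} [∀ j, IsProbabilityMeasure (μ j)]
  {S : R → (∀ j, X j) → ℝ}

omit [DecidableEq R] [Fintype R] [DecidableEq ι] in
/-- Bounded actions make every tempered Gibbs law `Z_q⁻¹e^{−S_q}·⊗μ` a probability law. [ours] -/
theorem isProbabilityMeasure_piGibbsLaw_ptbcDensity {a b : ℝ}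
    (hab : ∀ q ω, a ≤ S q ω ∧ S q ω ≤ b) (q : R) :
    IsProbabilityMeasure (piGibbsLaw μ (ptbcDensity S q)) :=
  isProbabilityMeasure_piGibbsLaw (μ := μ) (p := ptbcDensity S q)
    (by rw [Ne, ENNReal.ofReal_eq_zero, not_le]; exact Real.exp_pos (-b)) ENNReal.ofReal_ne_top
    (fun ω => (ptbcDensity_pinched hab q ω).1) (fun ω => (ptbcDensity_pinched hab q ω).2)

omit [DecidableEq R] [DecidableEq ι] in
/-- **At stationarity the law of replica `r` IS its tempered Gibbs law**: the `r`-marginal of the PTBC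
target `⊗_q Z_q⁻¹e^{−S_q}·⊗μ` is `Z_r⁻¹e^{−S_r}·⊗μ` (for the periodic replica: the physical law — "no
reweighting"). [ours] -/
theorem ptbcTarget_marginal {a b : ℝ} (hab : ∀ q ω, a ≤ S q ω ∧ S q ω ≤ b)
    (r : R) : (ptbcTarget μ (ptbcDensity S)).map (Function.eval r) = piGibbsLaw μ (ptbcDensity S r) := by
  haveI := isProbabilityMeasure_piGibbsLaw_ptbcDensity (μ := μ) hab
  exact map_eval_pi (fun q => piGibbsLaw μ (ptbcDensity S q)) r

/-- **THE PHYSICAL REPLICA CONVERGES TO THE PHYSICAL LAW AT THE JOINT RATE.**  Full PTBC cycle (heat-bath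
scans through the list `l ∋` every site on every replica of the list `L ∋` every replica, swaps along any
list of pairs `P`, the lifted translation `T` of replica `r₀`), bounded measurable actions `a ≤ S_q ≤ b`:
for every replica `r`, initial joint law `μ₀`, time `t` and measurable event `B` of ONE replica's
configurations, `|μ₀Cᵗ(eval_r⁻¹ B) − (Z_r⁻¹e^{−S_r}·⊗μ)(B)| ≤ (1 − ((e^{−b}/e^{−a})^{|l|})^{|L|})ᵗ`.
[ours] -/
theorem ptbc_full_physicalMarginal (hS : ∀ q, Measurable (S q)) {a b : ℝ}
    (hab : ∀ q ω, a ≤ S q ω ∧ S q ω ≤ b) {l : List ι} (hl : ∀ j, j ∈ l) {L : List R} (hL : ∀ r, r ∈ L)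
    (P : List (R × R)) (T : (∀ j, X j) ≃ᵐ (∀ j, X j)) (hT : MeasurePreserving T (Measure.pi μ) (Measure.pi μ))
    (r₀ : R) (hST : ∀ ω, S r₀ (T ω) = S r₀ ω)
    (μ₀ : Measure (R → ∀ j, X j)) [IsProbabilityMeasure μ₀] (t : ℕ) (r : R) {B : Set (∀ j, X j)}
    (hB : MeasurableSet B) :
    |((fun ν : Measure (R → ∀ j, X j) =>
          ν.bind ((ptbcTranslation T T.measurable r₀ ∘ₖ ptbcSwaps S P) ∘ₖ
            replicaSweep (ptbcInReplica μ (ptbcDensity S) l) L))^[t] μ₀).real (Function.eval r ⁻¹' B)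
        - (piGibbsLaw μ (ptbcDensity S r)).real B| ≤
      (1 - (((ENNReal.ofReal (Real.exp (-b)) * (ENNReal.ofReal (Real.exp (-a)))⁻¹) ^ l.length) ^ L.length).toReal) ^ t := by
  haveI := isProbabilityMeasure_piGibbsLaw_ptbcDensity (μ := μ) hab
  have h := ptbc_full_uniformlyErgodic (μ := μ) hS hab hl hL P T hT r₀ hST μ₀ t
  exact abs_real_preimage_eval_sub_le (fun q => piGibbsLaw μ (ptbcDensity S q)) (fun A => h A) r hB

end PTBC

end Summit.Ventures.LatticeQCDFlow.Exactness

end
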